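import Mathlib
import Summits.NavierStokesRegularity.NavierStokesRegularity.Theses.EulerZoomLiouville
import Summits.NavierStokesRegularity.NavierStokesRegularity.Theorems.EulerZoomLiouvillePowerGaugeEulerLiouvilleLargeRho
import Summits.NavierStokesRegularity.NavierStokesRegularity.Theorems.EulerZoomLiouvillePowerGaugeEulerLiouvillePastIrrotational
import Summits.NavierStokesRegularity.NavierStokesRegularity.Theorems.EulerZoomLiouvillePowerGaugeEulerLiouvilleSwirlfreeLedgerDecay
import Summits.NavierStokesRegularity.NavierStokesRegularity.Theorems.EulerZoomLiouvillePowerGaugeEulerLiouvilleSwirlfreeLedgerFlow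
import Summits.NavierStokesRegularity.NavierStokesRegularity.Theorems.EulerZoomLiouvillePowerGaugeEulerLiouvilleSwirlfreeLedgerConfinement
import Literature.Analysis.FluidPDE.AxisymmetricEuler
import Literature.Analysis.FluidPDE.ClassicalSolution
import Literature.Analysis.FluidPDE.VectorCalculus
import HarnessLib.Audit

/-!
# Line `mirror-moment` (ideator ns-idea-11 g3, lens «complete» = program-completion) for the crux
# `EulerZoomLiouville.PowerGaugeEulerLiouville` (stmt-NavierStokesRegularity-19832)

PROGRAMME COMPLETED.  Choi–Jeong, *On vortex stretching for anti-parallel axisymmetric flows*, Amer. J. Math. 147 (2025) 1251–1284 =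
arXiv:2110.09079: for axisymmetric swirl-free Euler flows that are ODD in `z` with a sign on `ω_θ` in the upper half-space (the head-on
collision set-up of anti-parallel vortex rings) the axial first moment `Z(t) = ∬_{Π₊} −z ω_θ dr dz` is MONOTONE (Lemma 3.3, p. 12; "we were
not able to find a rigorous proof in the literature", p. 7; planar ancestor: Iftimie–Sideris–Gamblin, Comm. PDE 24 (1999)).  The authors use
it FORWARD, for growth.  Nobody has pointed it BACKWARD at ancient solutions: in the OUTGOING orientation (`sign ω_θ = sign z`, the time-reversal
of their set-up) the identity
        `d/dτ ∬ z ω_θ dr dz = ½ ∫_{axis} u_z(0,z)² dz + ∬ u_r² / r dr dz ≥ 0`          (AXIAL-MOMENT DRIFT; no sign hypothesis needed)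
makes `M(τ) = ∫_{ℝ³} |x₃| η dx = 2π ∬ |z||ω_θ| dr dz` (`η = |curl u|/r`, the axis ledger) NON-DECREASING in `τ`, hence BOUNDED ON THE WHOLE PAST by its
value at one late time: FREE AXIAL CONFINEMENT of the ledger mass (Markov: the ledger mass at `|x₃| > Z` is `≤ M(t₀)/Z` at every `τ ≤ t₀`), with
NO velocity-decay hypothesis at all (contrast: L1 `swirlfree-ledger` and g3's `casimir-floor` buy confinement from `‖u(τ)‖_∞ ≤ M(−τ)^{−κ}`).
Identity checked by hand on the Gaussian ring `ψ = r²e^{−(r²+z²)}`: both sides `= 2.8200` (`5/2·√(π/2) − √π/(4√2)` vs `√(2π) + √π/(4√2)`).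

THE KILL.  A late off-axis blob of positive ledger mass `m₀` and ledger sup `W` persists backward (material transport of `η`, `det Dφ = 1` — L1's landed
flow kit, location-free: M2), its avatar sits where `η > 0`, i.e. inside the member's vortex region `{r ≤ R₀(1+|τ|)^β}` (the stratum's RADIAL SPREADING
EXPONENT `β`), and by the moment bound at least half of its mass sits in `{|x₃| ≤ Z₀ := 2M(t₀)/m₀}`; so at EVERY past time a blob of mass `≥ m₀/2`,
sup `≤ W`, lies in `B(0, R₀(1+|τ|)^β + Z₀ + 1)`, and the CASIMIR FLOOR (M3 — the convex-duality enstrophy floor, stub shared verbatim with line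
`casimir-floor`) gives `∫ |curl u(τ)|² ≥ (m₀/2)²/(8π a(τ)(2+log⁺(…)))`, `a(τ) ≍ |τ|^β`.  Against the `E`-gauge `∫_{−A²}^0∫_{B(A)}|∇u|² ≤ cA^{1−ρ}` this is
impossible as soon as the blob is inside `B(A)` for `≫ A^{2−ρ+o(1)}` window times, i.e. `min(A², A^{1/β}) ≫ A^{2−ρ}` ⇔ **`β < 1/(2−ρ)`** (kernel-checked
`spreading_race`; `1/(2−ρ) ∈ (1/2, 2/3]`, `β = 0` = a fixed cylinder `r ≤ R₀` always dies).  Hence `curl u ≡ 0` on the past ⇒ landed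
`PastIrrotational.ae_eq_zero_of_gauge_of_pastIrrotational`.  By Choi–Jeong's own growth theorem (time-reversed) compactly supported outgoing members
MUST spread radially (`P = ∬_{Π₊} r²|ω_θ| ↑ ∞` backward), so `β > 0` is where such members could live; the line says they cannot live below `β = 1/(2−ρ)`.

THE STRATUM `IsMirrorOutgoing ρ u p`: classical axisymmetric swirl-free on `(−∞,0)`, mirror-equivariant `u(τ, σx) = σ u(τ,x)` (`σ` = reflection in
`x₃`), outgoing `x₃ · (r ω_θ) ≥ 0` (typed junk-free as `0 ≤ x 2 * swirl (curl (u τ)) x`), vorticity vanishing where `r > R₀(1+(−τ))^β` with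
`0 ≤ β < 1/(2−ρ)`, finite weighted energy/ledger moments per slice and locally-in-time bounded velocity (the integrability the drift identity and the
backward trajectories need).  Vorticity may be UNBOUNDED IN `x₃`-EXTENT and of INFINITE VOLUME (not inside L3 `vortex-volume`), velocity need not
decay in `τ` (not inside L1 / `casimir-floor`), the member need not be self-similar / periodic / steady (none of `birth` v36's strata).

Stubs: M1 `stub_momentMonotone` (M+, THE NEW LEVER), M2 `stub_blobPersistence` (M, L1 flow kit, location-free), M3 `stub_casimirFloor` (M, shared
with `casimir-floor` — one proof closes both), M4 `stub_mirrorEndgame` (M, bookkeeping + E-gauge + landed filler), M5 `stub_nonMirrorRest` (OPEN residue,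
NOT claimed).  Composition `PowerGaugeEulerLiouville_of` kernel-checked; sorries only in `stub_*`.

DISTANCE LABEL (idea-crit-8 V mirror-moment 2026-08-28T07:28:53Z, PASS-WITH-PRICE light, P1): deliverable = the STRATUM theorem «classical
mirror-outgoing swirl-free members of the ρ-class with radial spreading exponent β < 1/(2−ρ) are trivial»; the residue M5 is crux-sized, NOT claimed,
zero width.  CANDIDATES THE STRATUM IS MEANT TO CONTAIN (honest): the natural outgoing ancient configurations are TIME-REVERSED HEAD-ON COLLISIONS
`v(τ) = −u(−τ)` of forward-global swirl-free collisions (Choi–Jeong's set-up).  Their backward radial spreading exponent is, in print, only bracketed: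
β_coll ≥ 1/15− (Choi–Jeong Thm 1.1 / Cor 1.2, p.4: diam ≳ t^{1/15−}) and β_coll ≤ 2 (Feng–Šverák, quoted ibid. p.6); the MODEL pictures give β_coll = 1
(Dyson / localized induction, p.5: ‖ω‖_∞ ∼ t) and β_coll = 4/3 (Childress ansatz R³a⁴ ∼ 1, Ṙ ∼ Ra, Sadovskii-profile numerics [ChildGil], p.6).  The
stratum window β < 1/(2−ρ) ∈ (1/2, 2/3] lies BELOW both model rates, so WITH RESPECT TO THAT FAMILY THE STRATUM IS THIN: it contains only anomalously
slow-spreading outgoing members (β ≤ 2/3), which no model predicts and no theorem excludes (rigorous floor 1/15).  Expected β of the collision family: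
1 – 4/3 (models); rigorously unknown within [1/15, 2].  (Aside, gauge arithmetic not claimed as a theorem: for the model family the E-gauge alone already
fails — enstrophy ∼ R(τ)² grows like |τ|^{2β} while the rings are inside B(a), so ∫∫_{Q_a}|∇v|² ≳ a^{2+1/β} ≫ c a^{1−ρ} — i.e. those candidates sit outside
the class for gauge reasons, not because of this line.)  P2 (staffing, verbatim): NO separate seat — ONE unit with casimir-floor's prover: K2 ≡ M3 first
(one proof closes both floors), K1 then M2 (same flow kit; M2 location-free), then M1 (land it Literature-grade: «axial vorticity moment of
mirror-symmetric swirl-free Euler is monotone», cite Choi–Jeong L3.3), M4/K3 last; zero width on M5/K4.  P3: none.  Crux 19832, N0 and NS regularity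
stay OPEN.  No summit is proved by a line.
-/

open MeasureTheory Set Filter Topology Metric Real
open scoped ENNReal NNReal
open Literature.Analysis Literature.Analysis.FluidPDE

set_option linter.dupNamespace false

namespace Summit.NavierStokesRegularity.NavierStokesRegularity.Cruxes.PowerGaugeEulerLiouville.MirrorMoment

/-- Local abbreviation: ℝ³. -/
abbrev E3 : Type := EuclideanSpace ℝ (Fin 3)

/-- Membership in Seregin's power-gauged ancient Euler class — verbatim the three hypotheses of the crux (same as `Birth.InClass`). -/
@[reducible] def InClass (ρ : ℝ) (u : ℝ → E3 → E3) (p : ℝ → E3 → ℝ) (H : ℝ → E3 → E3 →L[ℝ] E3)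
    (c : ℝ≥0) : Prop :=
  IsSuitableWeakSolutionOn (slab (EuclideanSpace ℝ (Fin 3)) (Set.Iio 0) isOpen_Iio) 0 0 u p ∧
    HasWeakSpatialGradientOn (slab (EuclideanSpace ℝ (Fin 3)) (Set.Iio 0) isOpen_Iio) u H ∧
    (∀ a : ℝ, 0 < a →
      ENNReal.ofReal (a ^ (2 * ρ)) * cknA a (0 : ℝ × E3) u + ENNReal.ofReal (a ^ ρ) * cknE a (0 : ℝ × E3) H +
        ENNReal.ofReal (a ^ (2 * ρ)) * cknD a (0 : ℝ × E3) p ≤ (c : ℝ≥0∞))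

/-- The conclusion of the crux: `u` vanishes a.e. on the past slab. -/
@[reducible] def VanishesAE (u : ℝ → E3 → E3) : Prop :=
  Function.uncurry u =ᵐ[volume.restrict (Set.Iio (0 : ℝ) ×ˢ (Set.univ : Set E3))] 0

/-- The axis ledger density `η(v)(x) = |curl v (x)| / r(x)` (junk value `0` on the axis); `= |ω_θ|/r` for swirl-free axisymmetric fields
(`div_cylRadius_eq_abs_omegaTilde`), materially conserved by classical swirl-free axisymmetric Euler (Majda–Bertozzi §2.3.3). -/
noncomputable def axisLedger (v : E3 → E3) (x : E3) : ℝ :=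
  ‖curl v x‖ / cylRadius x

/-- Reflection in the plane `x₃ = 0`: `σ(x₀,x₁,x₂) = (x₀,x₁,−x₂)`. -/
noncomputable def reflZ (x : E3) : E3 :=
  x - (2 * x 2) • (eZ : E3)

/-- The AXIAL LEDGER MOMENT `M(v) = ∫_{ℝ³} |x₃| η(v) dx` (`= 2π ∬ |z||ω_θ| dr dz` for swirl-free axisymmetric `v`). -/
noncomputable def axialMoment (v : E3 → E3) : ℝ :=
  ∫ x, |x 2| * axisLedger v x

/-- Classical MIRROR-OUTGOING member with radial data `(R₀, β)`: classical Euler on `(−∞,0) × ℝ³`; axisymmetric swirl-free slices; mirror-equivariant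
under `σ`; outgoing sign `x₃ · (r ω_θ)(x) ≥ 0` (`swirl (curl v) x = x₀ (curl v)₁ − x₁ (curl v)₀ = r ω_θ`, junk-free); vorticity vanishes where
`r > R₀ (1 + (−τ))^β` (`0 ≤ R₀`, `0 ≤ β`); per slice, finite weighted energy `∫(1+|x|)|u|² < ∞` and weighted ledger `∫(1+|x|) η < ∞`; velocity bounded
on every compact past time-slab. -/
def IsMirrorOutgoingWith (u : ℝ → E3 → E3) (p : ℝ → E3 → ℝ) (R₀ β : ℝ) : Prop :=
  IsClassicalEulerSolutionOn (Set.Iio 0) 0 u p ∧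
    (∀ τ : ℝ, τ < 0 → IsAxisymmetric (u τ) ∧ HasNoSwirl (u τ)) ∧
    (∀ τ : ℝ, τ < 0 → ∀ x : E3, u τ (reflZ x) = reflZ (u τ x)) ∧
    (∀ τ : ℝ, τ < 0 → ∀ x : E3, 0 ≤ x 2 * swirl (curl (u τ)) x) ∧
    0 ≤ R₀ ∧ 0 ≤ β ∧ (∀ τ : ℝ, τ < 0 → ∀ x : E3, R₀ * (1 + -τ) ^ β < cylRadius x → curl (u τ) x = 0) ∧
    (∀ τ : ℝ, τ < 0 →
      Integrable (fun x : E3 => (1 + ‖x‖) * ‖u τ x‖ ^ 2) ∧ Integrable (fun x : E3 => (1 + ‖x‖) * axisLedger (u τ) x)) ∧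
    (∀ T T' : ℝ, T ≤ T' → T' < 0 → ∃ B : ℝ, ∀ τ ∈ Set.Icc T T', ∀ x : E3, ‖u τ x‖ ≤ B)

/-- THE STRATUM (depends on `ρ` through the spreading threshold): radial spreading exponent `β < 1/(2−ρ)`. -/
def IsMirrorOutgoing (ρ : ℝ) (u : ℝ → E3 → E3) (p : ℝ → E3 → ℝ) : Prop :=
  ∃ R₀ β : ℝ, β < 1 / (2 - ρ) ∧ IsMirrorOutgoingWith u p R₀ β

/-- The axial ledger moment is non-decreasing on the past (conclusion shape of M1). -/
def MomentMonotone (u : ℝ → E3 → E3) : Prop :=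
  ∀ τ₁ τ₂ : ℝ, τ₁ ≤ τ₂ → τ₂ < 0 → axialMoment (u τ₁) ≤ axialMoment (u τ₂)

/-- LEDGER BLOBS PERSIST BACKWARD, location-free form (conclusion shape of M2): a late off-axis ball on which `η ≤ W` has at every earlier time a
measurable avatar on which `0 < η ≤ W` and whose ledger mass is at least the ball's (truth: avatar = backward flow image of the ball's `{η > 0}` part). -/
def BlobsPersist (u : ℝ → E3 → E3) : Prop :=
  ∀ t₀ : ℝ, t₀ < 0 → ∀ (x₀ : E3) (δ W : ℝ), 0 < δ → δ < cylRadius x₀ →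
    (∀ x ∈ ball x₀ δ, axisLedger (u t₀) x ≤ W) →
    ∀ τ : ℝ, τ < t₀ →
      ∃ T : Set E3, MeasurableSet T ∧ (∀ y ∈ T, 0 < axisLedger (u τ) y ∧ axisLedger (u τ) y ≤ W) ∧
        ∫⁻ x in ball x₀ δ, ENNReal.ofReal (axisLedger (u t₀) x) ≤ ∫⁻ y in T, ENNReal.ofReal (axisLedger (u τ) y)

/-- THE CASIMIR FLOOR (verbatim the statement of line `casimir-floor`, K2 there): a `C¹` field, a measurable blob `T ⊆ B(0,a)` with ledger density `≤ W`
and ledger mass `≥ m > 0` has enstrophy `∫_T |curl v|² ≥ m²/(8πa(2+log⁺(a³W/m)))`. -/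
def CasimirFloor : Prop :=
  ∀ (v : E3 → E3) (T : Set E3) (a W m : ℝ), ContDiff ℝ 1 v → 0 < a → 0 < W → 0 < m → MeasurableSet T →
    T ⊆ ball (0 : E3) a → (∀ x ∈ T, axisLedger v x ≤ W) →
    ENNReal.ofReal m ≤ ∫⁻ x in T, ENNReal.ofReal (axisLedger v x) →
      ENNReal.ofReal (m ^ 2 / (8 * π * a * (2 + max 0 (Real.log (a ^ 3 * W / m))))) ≤
        ∫⁻ x in T, ENNReal.ofReal (‖curl v x‖ ^ 2)

/-! ## Registered stub signatures -/

/-- Signature of `stub_momentMonotone` (M1, size M+, THE NEW LEVER): for classical mirror-outgoing members the axial ledger moment is non-decreasing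
in time.  Proof: `η = ω_θ/r` is transported by the planar flow `(u_r,u_z)`, which preserves `r dr dz`; with the test function `z` (truncated, errors
controlled by the weighted integrability clause) `d/dτ ∬ z ω_θ dr dz = ∬ u_z ω_θ dr dz`; with `ω_θ = ∂_z u_r − ∂_r u_z`, `div u = 0`
(`∂_r u_r + u_r/r + ∂_z u_z = 0`) and two integrations by parts (`u_r = 0` on the axis, decay from the energy clause):
`∬ u_z ω_θ dr dz = ½∫ u_z(0,z)² dz + ∬ u_r²/r dr dz ≥ 0`; the outgoing sign makes `2π∬ z ω_θ dr dz = ∫|x₃| η dx = axialMoment`.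
(Choi–Jeong arXiv:2110.09079 Lemma 3.3 is the same identity in the time-reversed orientation, for compactly supported data.) -/
def Sig.stub_momentMonotone : Prop :=
  ∀ (u : ℝ → E3 → E3) (p : ℝ → E3 → ℝ) (R₀ β : ℝ), IsMirrorOutgoingWith u p R₀ β → MomentMonotone u

/-- Signature of `stub_blobPersistence` (M2, size M): classical mirror-outgoing members have persistent ledger blobs (location-free).  Proof: backward
particle trajectories exist globally on `[τ, t₀]` (velocity bounded on the slab — last clause of the stratum — and smooth: cut-off flow kit
`isUniformlyLipschitzOn_bump_smul` on growing balls), stay off the axis (`cylRadius_evolutionMap_ne_zero`), transport `η`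
(`omegaTilde_evolutionMap_eq` + `div_cylRadius_eq_abs_omegaTilde`), and preserve volume (`det_fderiv_evolutionMap_eq_one_of_divergence`,
`lintegral_comp_evolutionMap_le`); avatar := image of `ball x₀ δ ∩ {η(t₀,·) > 0}` (open), so `0 < η ≤ W` on it and the mass is carried. -/
def Sig.stub_blobPersistence : Prop :=
  ∀ (u : ℝ → E3 → E3) (p : ℝ → E3 → ℝ) (R₀ β : ℝ), IsMirrorOutgoingWith u p R₀ β → BlobsPersist u

/-- Signature of `stub_casimirFloor` (M3, size M; SHARED VERBATIM with line `casimir-floor` K2 — pointwise `c² ≥ 2cv − ψ_B(v)`, cylindrical shell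
integral `∫_{B(a)} ψ_{Wr}(s/r) ≤ πas²(3+2log(a²W/s))`, `s = m/(8πaL)`). -/
def Sig.stub_casimirFloor : Prop := CasimirFloor

/-- Signature of `stub_mirrorEndgame` (M4, size M): GIVEN the floor, a member of the class (`0 < ρ ≤ 1/2`) that is mirror-outgoing with spreading exponent
`β < 1/(2−ρ)`, has monotone axial moment and persistent blobs, is trivial.  Proof: if `curl (u t₀) x₀ ≠ 0` with `t₀ < 0`, `x₀` off the axis (else
`curl ≡ 0` by continuity), pick `δ < r(x₀)/2`, `W = max 1 (sup_{B(x₀,δ)} η)`, `m₀ = ∫_{B(x₀,δ)} η > 0`, `Z₀ = 2 M(u t₀)/m₀` (finite by the weighted-ledger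
clause).  For `τ < t₀` the avatar `T` (M2) lies in `{η(τ,·) > 0} ⊆ {curl ≠ 0} ⊆ {r ≤ R₀(1+(−τ))^β}`; `∫_T |y₃| η ≤ M(u τ) ≤ M(u t₀)` (M1), so
`T' = T ∩ {|y₃| ≤ Z₀}` has mass `≥ m₀/2` and `T' ⊆ B(0, R₀(1+(−τ))^β + Z₀ + 1)`.  For `A` large and `τ ∈ (−T_A, t₀)`, `T_A = min(A², (A/(2R₀))^{1/β})`
(`= A²` if `β = 0` or `R₀ = 0`), `T' ⊆ B(0,A)` and the floor gives `∫_{B(A)} |curl u(τ)|² ≥ (m₀/2)²/(8πA(2+log⁺(8A³W/m₀)))`; integrate over `τ` and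
compare with `∫_{−A²}^0∫_{B(A)} |curl u|² ≤ 2cA^{1−ρ}` (`setLIntegral_window_frobenius_fderiv_le`, `sq_norm_curl_le_frobeniusNormSq`): contradiction
as `A → ∞` because `min(2, 1/β) > 2 − ρ` iff `β < 1/(2−ρ)` (`spreading_race`).  Hence `curl u ≡ 0` on `(−∞,0) × ℝ³` and
`PastIrrotational.ae_eq_zero_of_gauge_of_pastIrrotational` (`T₁ = 0`, `C²` slices, `div u = 0`) concludes. -/
def Sig.stub_mirrorEndgame : Prop :=
  CasimirFloor →
    ∀ ρ : ℝ, 0 < ρ → ρ ≤ 1 / 2 → ∀ (u : ℝ → E3 → E3) (p : ℝ → E3 → ℝ) (H : ℝ → E3 → E3 →L[ℝ] E3) (c : ℝ≥0),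
      InClass ρ u p H c → ∀ R₀ β : ℝ, β < 1 / (2 - ρ) → IsMirrorOutgoingWith u p R₀ β →
        MomentMonotone u → BlobsPersist u → VanishesAE u

/-- Signature of `stub_nonMirrorRest` (M5, OPEN, crux-sized — NOT claimed by this line): in the window `0 < ρ ≤ 1/2`, members OUTSIDE the stratum are
trivial.  This is where `birth`'s open stubs live, minus the stratum. -/
def Sig.stub_nonMirrorRest : Prop :=
  ∀ ρ : ℝ, 0 < ρ → ρ ≤ 1 / 2 → ∀ (u : ℝ → E3 → E3) (p : ℝ → E3 → ℝ) (H : ℝ → E3 → E3 →L[ℝ] E3) (c : ℝ≥0),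
    InClass ρ u p H c → ¬ IsMirrorOutgoing ρ u p → VanishesAE u

/-! ## Stubs -/

/-- STUB M1 [provable, M+; the new lever]. -/
theorem stub_momentMonotone : Sig.stub_momentMonotone := by
  sorry

/-- STUB M2 [provable, M]. -/
theorem stub_blobPersistence : Sig.stub_blobPersistence := by
  sorry

/-- STUB M3 [provable, M; shared with `casimir-floor`]. -/
theorem stub_casimirFloor : Sig.stub_casimirFloor := by
  sorry

/-- STUB M4 [provable, M]. -/
theorem stub_mirrorEndgame : Sig.stub_mirrorEndgame := by
  sorry

/-- STUB M5 [OPEN residue, not claimed]. -/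
theorem stub_nonMirrorRest : Sig.stub_nonMirrorRest := by
  sorry

/-! ## Sanity checks on the stratum (kernel-checked) -/

/-- `σ` is the coordinate reflection: `(σ x)₂ = −x₂`, `(σ x)₀ = x₀`, `(σ x)₁ = x₁`. -/
theorem reflZ_apply_two (x : E3) : reflZ x 2 = -(x 2) := by
  simp [reflZ, eZ]
  ring

theorem reflZ_apply_zero (x : E3) : reflZ x 0 = x 0 := by
  simp [reflZ, eZ]

theorem reflZ_apply_one (x : E3) : reflZ x 1 = x 1 := by
  simp [reflZ, eZ]

/-- The spreading threshold exceeds `1/2` for every `ρ ∈ (0,2)`: a fixed cylinder (`β = 0`) and diffusive spreading (`β = 1/2`) always die. -/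
theorem half_lt_threshold {ρ : ℝ} (hρ : 0 < ρ) (hρ2 : ρ < 2) : (1 : ℝ) / 2 < 1 / (2 - ρ) := by
  rw [div_lt_div_iff₀ (by norm_num) (by linarith)]
  linarith

/-- At the energy endpoint `ρ = 1/2` the threshold is `2/3`. -/
example : (1 : ℝ) / (2 - 1 / 2) = 2 / 3 := by norm_num

/-- The exponent race behind M4: for `β > 0` and `ρ < 2`, `1/β > 2 − ρ ↔ β < 1/(2−ρ)`. -/
theorem spreading_race {ρ β : ℝ} (hβ : 0 < β) (hρ2 : ρ < 2) :
    2 - ρ < 1 / β ↔ β < 1 / (2 - ρ) := by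
  have h2 : 0 < 2 - ρ := by linarith
  rw [lt_div_iff₀ hβ, lt_div_iff₀ h2]
  constructor <;> intro h <;> nlinarith

/-! ## Composition -/

/-- **Composition (kernel-checked, no sorry of its own): the five stubs give the crux BY NAME.** -/
theorem PowerGaugeEulerLiouville_of :
    Sig.stub_momentMonotone → Sig.stub_blobPersistence → Sig.stub_casimirFloor → Sig.stub_mirrorEndgame →
      Sig.stub_nonMirrorRest →
      Summit.NavierStokesRegularity.NavierStokesRegularity.Theses.EulerZoomLiouville.PowerGaugeEulerLiouville := by
  intro h1 h2 h3 h4 h5 ρ hρ u p H c hsw hH hc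
  by_cases hhalf : 1 / 2 < ρ
  · exact
      Summit.NavierStokesRegularity.NavierStokesRegularity.Theorems.PowerGaugeEulerLiouville.powerGaugeEulerLiouville_largeRho
        ρ hhalf u p H c hsw hH hc
  · have hρ2 : ρ ≤ 1 / 2 := not_lt.mp hhalf
    by_cases hS : IsMirrorOutgoing ρ u p
    · obtain ⟨R₀, β, hβ, hM⟩ := hS
      exact h4 h3 ρ hρ hρ2 u p H c ⟨hsw, hH, hc⟩ R₀ β hβ hM (h1 u p R₀ β hM) (h2 u p R₀ β hM)
    · exact h5 ρ hρ hρ2 u p H c ⟨hsw, hH, hc⟩ hS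

end Summit.NavierStokesRegularity.NavierStokesRegularity.Cruxes.PowerGaugeEulerLiouville.MirrorMoment
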